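import Summits.QuantumFields.YangMills.Theorems.BalabanUVNodesN15TwoSpacingGluingNeumannKnit
import Summits.QuantumFields.YangMills.Theorems.BalabanUVNodesN15TwoSpacingGluingNeumannCoverRows
import Summits.QuantumFields.YangMills.Theorems.BalabanUVNodesN15NeumannCubeLiftConvolution
import Summits.QuantumFields.YangMills.Theorems.BalabanUVNodesN15NeumannCubeLiftSpacing
import HarnessLib

/-!
# THE GLUING STEP AT TWO LATTICE SPACINGS, XXXI: THE KNIT ON THE TORUS OF RECORD — CUBES OF FIXED SIDE `L^{s+1}` LIFTED FROM THEIR DOUBLED TORUS (dag-n15-a PROGRAMME P), THE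
# VOLUME `2L^{m_T}` FREE: `G₀(1 − R)⁻¹ = Δ_a⁻¹` AND DECAYS FOR `L^s ≥ w₀`, `w₀, B, δ` UNIFORM IN THE VOLUME AND THE SPACING (dag-n15-c g12, FILE 73; N15 = NE2, s1 «background-layer
# OPERATOR ingredient» — the non-circular edition of FILE 70)

Cell `pub-ymgap`, seat `pub-ymgap-dag-n15-c` (R134 (a); HUMAN RULING D-0062), generation 12.  `bears_on: R4∕N15 · K3⁷ SpineGivenEndpointR13SepCoPH (stmt-QuantumFields-20544)`.
Filed `--supports stmt-QuantumFields-20544 --as helper` — COUNT-NEUTRAL.  Three plumbing `def`s (`knitHR`, `knitGR`, `knitGluedR`: the cover's partition, the lifted cubes, the glued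
operator on the torus of record), the rest theorems; 0 `sorry`.  Imports BY NAME FILE 70 (`coverMargin`, `coverMargin_fit`, `le_two_mul_coverMargin`), FILE 72 (`hasMaj_commOp_comp_cover_of`,
`sum_ind_cubeBlocks_le_overlap`, the side-`S` window lemmas), FILE 69 (`deltaOp_eq_lapOp_zero_add`, `hasMaj_nonlocalPart`, `hasMaj_rate_le`), dag-n15-a PROGRAMME P: P-IIb `hasMaj_chiCube_liftCubeG` ∕
`hasMaj_chiCube_grad_liftCubeG` ∕ `mulOp_comp_deltaOp_comp_liftCubeG_family`, P-IId `hasMaj_chiCube_divAdjOut_liftCubeG_pair`, P-IIe `hasMaj_chiCube_comp_liftCubeG_family` ((β′)), part 41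
`hasMaj_landauRe`; nothing in the tree is modified.

WHAT.  On the torus of record `M = MP (paramsOf d L m_T K hL)` (`M_ν = 2L^{m_T}`, spacing `L^{−K}`), cubes of side `S = L^{s+1}` (`s + 1 ≤ m_T`), resolution `w = L^s`, `q = L^{m_T − s}`
(`M_ν = 2qw`), margin `m₀ = coverMargin L s`, partition `h_k = hcube (2q) (coverXi M (L^K) (L^s)) k`, cubes `G_k = liftCubeG (L^K) (MP_dvd_MP …) (coverCorner M (L^s) q m₀ k) (L^{s+1}) a`
(the Neumann propagator of the doubled cube torus `2L^{s+1}` lifted along the reduction), `k ∈ (ℤ∕2q)^{d+1}` — `(2q)^{d+1}` cubes, TRUE overlap `(L + 1)^{d+1}`: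
* §1 ★★ `remainderConstR_le` (the remainder constant `Θ ≤ κ₀∕w` for `1 ≤ w ≤ 2(m₀+1)`, abstract letters);
* §2 `knitHR`, `knitGR`, `knitGluedR`; ★★★ **`knitGluedR_spec`**: `∃ δ w₀ B > 0, ∀ s m_T K (s + 1 ≤ m_T) (1 ≤ K), w₀ ≤ L^s →` (i) `Δ_a ∘ G_glued = 1`, (ii) `G_glued ∘ Δ_a = 1`,
  (iii) `G_glued = Δ_a⁻¹ = G` (uniqueness), (iv) `G_glued ≤ B·e^{−δ|y − y′|_T}` — with `δ, w₀, B` free of the VOLUME `m_T`, the spacing `K` and the cube exponent `s`.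
  The remainder row of each cube is FILE 72 `hasMaj_commOp_comp_cover_of` on P-IIb∕P-IId's cut rows (`symbOp_sD_eq`, `bgrad_eq_neg_symbOp`), the commutator half (β′) behind FILE 72
  `hasMaj_commOp_coverH`, `N′`'s letter FILE 69 `hasMaj_nonlocalPart`; (2.36) `sum_coverH_sq`; (2.91) FILE 45 `lap_comp_parametrix` on P-IIb's exact locality and FILE 72
  `mem_intBonds_of_hcube_ne_zero_side`; the unit and the letter FILE 43 `isUnit_neumannR` ∕ `hasMaj_glueInv_of_M`, FILE 45 `hasMaj_parametrix` (cut: FILE 63 `parametrix_cut`), FILE 57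
  `hasMaj_remainder_in` with `N_ov = (L+1)^{d+1}` (FILE 72 `sum_ind_cubeBlocks_le_overlap`).

HONEST FRAMING ∕ LIMITS.  The COMPOSITION CERTIFICATE of [B6] §2's parametrix machine ((2.36)–(2.37) p.229, (2.91)–(2.93) p.239, (2.133)–(2.136) p.247) at `U ≡ 1` on the torus of
record with cubes of FIXED size: the cube letters come from dag-n15-a's doubled-cube tori `2L^{s+1}` (their part 12 ∕ (1.110) AT THE CUBE TORUS, uniform in the volume), so — unlike FILE 70 —
the decay constant `B, δ` of `G = Δ_a⁻¹` on `Tor(2L^{m_T})` is obtained from data that do not involve the big torus's own propagator letters except through `∂Π∂*`'s letter (part 41) and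
the uniqueness clause (iii).  Background-live cube letters (dag-n15-w3) and the η-defect ∕ `NE2PlusOperator` socket (FILE 50) are the sequel.  Nothing of [B5]∕[B6]∕[B9] asserted.  NE2⁺ NOT
PRINTED, NOT proved; N15 NOT discharged; counts of record UNMOVED (typed 28∕28 · discharged 5∕27); one finite 𝕋⁴ at fixed ε per index — NOT infinite volume, NOT OS on ℝ⁴, NOT a mass
gap, NOT Clay; R4 closes the conditional finite-𝕋⁴ rung `BalabanLadder.UV` only.  Restate-immune (no Theses import).
-/

noncomputable section

namespace Summit.QuantumFields.YangMills.BalabanUVNodes.N15.Gluing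

open Real
open Literature.MathematicalPhysics.QuantumFieldTheory.Balaban1983to89
open Literature.MathematicalPhysics.QuantumFieldTheory.Balaban1983to89.B5Prop11Plancherel (Tor fine)
open Literature.MathematicalPhysics.QuantumFieldTheory.Balaban1983to89.B11SectG (BlockNorm HasMaj RowSum)
open Literature.MathematicalPhysics.QuantumFieldTheory.Balaban1983to89.B6Prop26Gluing (mulOp ind ind_nonneg ind_le_one)
open Literature.MathematicalPhysics.QuantumFieldTheory.Balaban1983to89.B6UnitTorusCarrier (unitTorusGeo triangle254_unitTorusGeo rowSum_unitTorusGeo unitTorusGeo_dist_nonneg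
  unitTorusGeo_dist_self)
open Literature.MathematicalPhysics.QuantumFieldTheory.Balaban1983to89.B5SiteBridgeP12 (MP)
open Literature.MathematicalPhysics.QuantumFieldTheory.King1986.Torus (blockOf tdistT tdistT_nonneg)
open Summit.QuantumFields.YangMills.BalabanUVNodes.N15.VectorPiece (bshiftEquiv)
open Summit.QuantumFields.YangMills.BalabanUVNodes.N15.BackgroundLayer (fgrad bgrad symbOp_sD_eq)
open Summit.QuantumFields.YangMills.BalabanUVNodes.N15.TwoGrid (symbOp sD sTinv paramsOf deltaOp gOp chiCube cubeBlocks liftCubeG MP_dvd_MP gOp_comp_deltaOp hasMaj_landauRe landauRe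
  qvRe qvAdjRe hasMaj_chiCube_liftCubeG hasMaj_chiCube_grad_liftCubeG hasMaj_chiCube_divAdjOut_liftCubeG_pair hasMaj_chiCube_comp_liftCubeG_family
  mulOp_comp_deltaOp_comp_liftCubeG_family)

variable {d : ℕ}

/-! ## §1 The remainder constant is `O(w⁻¹)` (abstract letters) -/

section Small

/-- ★★ **the remainder constant of FILE 72's row is `≤ κ₀∕w`** for `1 ≤ w ≤ 2(m₀+1)`: the local part carries `w⁻²`, `w⁻¹`, the commutator half carries `[N′, M_h] = O(w⁻¹)`, the far half
`e^{−(δ_m∕4)(m₀+1)} ≤ 8∕(δ_m w)`; `κ₀` is free of `w, m₀`. [cite: Balaban1984PropagatorsII, (2.134)–(2.135) p.247 («O(M⁻¹)»: shape)] -/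
theorem remainderConstR_le (d : ℕ) {βG β₁ CC cN δm cr w m₀ : ℝ} (hβG : 0 ≤ βG) (hcN : 0 ≤ cN) (hδm : 0 < δm) (hcr : 0 ≤ cr) (hw : 1 ≤ w) (hwm : w ≤ 2 * (m₀ + 1)) :
    (((d + 1 : ℕ) * (32 * π ^ 2 / w ^ 2 * βG + 2 * (π / w * β₁)) + 0) +
          2 ^ (d + 1) * ((π * (d + 1) / w * (Real.exp 1 * (δm / 4))⁻¹ + 2 * (π * (d + 1) / w)) * cN * CC * cr) +
          cN * Real.exp (-((δm - 3 * δm / 4) * (m₀ + 1))) * βG * cr) ≤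
      (((d + 1 : ℕ) * (32 * π ^ 2 * βG + 2 * (π * β₁))) + 2 ^ (d + 1) * ((π * (d + 1) * (Real.exp 1 * (δm / 4))⁻¹ + 2 * (π * (d + 1))) * cN * CC * cr) +
        cN * (8 / δm) * βG * cr) / w := by
  have hw0 : 0 < w := by linarith
  set E : ℝ := (Real.exp 1 * (δm / 4))⁻¹ with hE
  have t1 : ((d + 1 : ℕ) * (32 * π ^ 2 / w ^ 2 * βG + 2 * (π / w * β₁))) + 0 ≤ (d + 1 : ℕ) * (32 * π ^ 2 * βG + 2 * (π * β₁)) / w := by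
    have hsq : 32 * π ^ 2 / w ^ 2 * βG ≤ 32 * π ^ 2 * βG / w := by
      rw [div_mul_eq_mul_div]
      exact div_le_div_of_nonneg_left (by positivity) hw0 (by nlinarith)
    have e2 : (d + 1 : ℕ) * (32 * π ^ 2 * βG + 2 * (π * β₁)) / w = (d + 1 : ℕ) * (32 * π ^ 2 * βG / w + 2 * (π / w * β₁)) := by ring
    rw [e2, add_zero]
    exact mul_le_mul_of_nonneg_left (by linarith) (by positivity)
  have t2 : 2 ^ (d + 1) * ((π * (d + 1) / w * E + 2 * (π * (d + 1) / w)) * cN * CC * cr) = 2 ^ (d + 1) * ((π * (d + 1) * E + 2 * (π * (d + 1))) * cN * CC * cr) / w := by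
    ring
  have t3 : cN * Real.exp (-((δm - 3 * δm / 4) * (m₀ + 1))) * βG * cr ≤ cN * (8 / δm) * βG * cr / w := by
    have hx : 0 < δm / 4 * (m₀ + 1) := mul_pos (by positivity) (by linarith)
    have hexp : Real.exp (-((δm - 3 * δm / 4) * (m₀ + 1))) ≤ (δm / 4 * (m₀ + 1))⁻¹ := by
      rw [show (δm - 3 * δm / 4) * (m₀ + 1) = δm / 4 * (m₀ + 1) by ring, Real.exp_neg]
      exact inv_anti₀ hx (by linarith [Real.add_one_le_exp (δm / 4 * (m₀ + 1))])
    have hinv : (δm / 4 * (m₀ + 1))⁻¹ ≤ (δm * w / 8)⁻¹ := inv_anti₀ (by positivity) (by nlinarith)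
    calc cN * Real.exp (-((δm - 3 * δm / 4) * (m₀ + 1))) * βG * cr = cN * βG * cr * Real.exp (-((δm - 3 * δm / 4) * (m₀ + 1))) := by ring
      _ ≤ cN * βG * cr * (δm * w / 8)⁻¹ := mul_le_mul_of_nonneg_left (hexp.trans hinv) (by positivity)
      _ = cN * (8 / δm) * βG * cr / w := by field_simp
  have hsum : (d + 1 : ℕ) * (32 * π ^ 2 * βG + 2 * (π * β₁)) / w + 2 ^ (d + 1) * ((π * (d + 1) * E + 2 * (π * (d + 1))) * cN * CC * cr) / w + cN * (8 / δm) * βG * cr / w =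
      (((d + 1 : ℕ) * (32 * π ^ 2 * βG + 2 * (π * β₁))) + 2 ^ (d + 1) * ((π * (d + 1) * E + 2 * (π * (d + 1))) * cN * CC * cr) + cN * (8 / δm) * βG * cr) / w := by
    ring
  linarith [t1, t2.le, t3, hsum.le, hsum.ge]

end Small

/-! ## §2 The knit on the torus of record -/

section Knit

variable (d) (L : ℕ) [NeZero L]

/-- THE COVER's PARTITION FAMILY at spacing `n` on the torus of record `M = MP (paramsOf d L m_T K hL)` (`M_ν = 2L^{m_T} = 2·L^{m_T−s}·L^s`): `h_k = Π_ν Θ_{2q}(x_ν∕(nL^s) − k_ν)`,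
`k ∈ (ℤ∕2q)^{d+1}`, `q = L^{m_T − s}`. [cite: Balaban1984PropagatorsII, (2.36) p.229 (shape)] -/
def knitHR (s mT K n : ℕ) (hL : Odd L ∧ 1 < L) (k : Fin (d + 1) → ZMod (2 * L ^ (mT - s))) : Tor (fine n (MP (paramsOf d L mT K hL))) × Fin (d + 1) → ℝ :=
  hcube (2 * L ^ (mT - s)) (coverXi (MP (paramsOf d L mT K hL)) n (L ^ s)) k

/-- THE COVER's CUBE FAMILY on the torus of record: the Neumann propagators of the translated cubes `□_k = c(k) + [0, L^{s+1})^{d+1}` LIFTED from their doubled torus `2L^{s+1}` (dag-n15-a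
`liftCubeG`). [cite: Balaban1984PropagatorsII, (2.37) p.229 (shape), p.238 (T_□)] -/
def knitGR (s mT K n : ℕ) [NeZero n] (hL : Odd L ∧ 1 < L) (hs : s + 1 ≤ mT) (a : ℝ) (k : Fin (d + 1) → ZMod (2 * L ^ (mT - s))) :
    (Tor (fine n (MP (paramsOf d L mT K hL))) × Fin (d + 1) → ℝ) →ₗ[ℝ] (Tor (fine n (MP (paramsOf d L mT K hL))) × Fin (d + 1) → ℝ) :=
  liftCubeG n (MP_dvd_MP hL hs K) (coverCorner (MP (paramsOf d L mT K hL)) (L ^ s) (L ^ (mT - s)) (coverMargin L s) k) (L ^ (s + 1)) a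

/-- THE GLUED OPERATOR `G₀(1 − R)⁻¹` of the cover on the torus of record (FILE 43 `glueInv` of FILE 45's `parametrix` ∕ `remainder` for Bałaban's `Δ_a` at `U ≡ 1`).
[cite: Balaban1984PropagatorsII, (2.91) p.239, p.247 («G = G₀(I − R)⁻¹»)] -/
def knitGluedR (s mT K n : ℕ) [NeZero n] (hL : Odd L ∧ 1 < L) (hs : s + 1 ≤ mT) (a : ℝ) :
    (Tor (fine n (MP (paramsOf d L mT K hL))) × Fin (d + 1) → ℝ) →ₗ[ℝ] (Tor (fine n (MP (paramsOf d L mT K hL))) × Fin (d + 1) → ℝ) :=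
  glueInv (parametrix (knitHR d L s mT K n hL) (knitGR d L s mT K n hL hs a))
    (remainder (deltaOp (MP (paramsOf d L mT K hL)) n a) (knitHR d L s mT K n hL) (knitGR d L s mT K n hL hs a))

variable {d L}

/-- the torus of record factorises: `2L^{m_T} = 2·L^{m_T − s}·L^s` (`s ≤ m_T`). [folklore] -/
theorem MP_eq_two_mul (L s mT K : ℕ) (hL : Odd L ∧ 1 < L) (hs : s ≤ mT) (ν : Fin (d + 1)) : MP (paramsOf d L mT K hL) ν = 2 * L ^ (mT - s) * L ^ s := by
  show 2 * L ^ mT = 2 * L ^ (mT - s) * L ^ s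
  rw [mul_assoc, ← pow_add, Nat.sub_add_cancel hs]

/-- ★★★ **THE KNIT ON THE TORUS OF RECORD**: for odd `L ≥ 3`, `a > 0` there are `δ, w₀, B > 0` such that for EVERY cube exponent `s`, EVERY volume exponent `m_T ≥ s + 1`, EVERY spacing
exponent `K ≥ 1` with `L^s ≥ w₀`: the glued operator of the cover by lifted Neumann cubes of side `L^{s+1}` is a TWO-SIDED inverse of `Δ_a` on `Tor(2L^{m_T})` at spacing `L^{−K}` (hence `=
G = Δ_a⁻¹`), and `G_glued ≤ B·e^{−δ|y − y′|_T}` blockwise — `δ, w₀, B` free of `m_T, K, s`.  Mechanism: (2.36) + per-cube locality ⟹ (2.91); remainder rows `O(w⁻¹)` (FILE 72 on PROGRAMME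
P's rows, (β′), §1) ⟹ `‖R‖ ≤ ½` for `L^s ≥ w₀` ⟹ Neumann series (FILE 43); uniqueness of the two-sided inverse. [cite: Balaban1984PropagatorsII, (2.36)–(2.37) p.229, (2.91)–(2.93) p.239,
(2.133)–(2.136) p.247 («G = G₀(I − R)⁻¹», «O(M⁻¹)»: mechanism); Balaban1985BackgroundPropagators, Thm 3.1 p.397 («for M ≥ M₁»: the guard, here `L^s ≥ w₀`)] -/
theorem knitGluedR_spec (hL : Odd L ∧ 1 < L) {a : ℝ} (ha : 0 < a) :
    ∃ δ w₀ B : ℝ, 0 < δ ∧ 0 < B ∧ ∀ (s mT K : ℕ) (hs : s + 1 ≤ mT), 1 ≤ K → w₀ ≤ ((L ^ s : ℕ) : ℝ) →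
      (deltaOp (MP (paramsOf d L mT K hL)) (L ^ K) a ∘ₗ knitGluedR d L s mT K (L ^ K) hL hs a = LinearMap.id ∧
        knitGluedR d L s mT K (L ^ K) hL hs a ∘ₗ deltaOp (MP (paramsOf d L mT K hL)) (L ^ K) a = LinearMap.id ∧
        knitGluedR d L s mT K (L ^ K) hL hs a = gOp (MP (paramsOf d L mT K hL)) (L ^ K) a) ∧
      HasMaj (BlockNorm.ofBlocks (unitTorusGeo L K (MP (paramsOf d L mT K hL)))
          (fun b : Tor (fine (L ^ K) (MP (paramsOf d L mT K hL))) × Fin (d + 1) => blockOf (L ^ K) (MP (paramsOf d L mT K hL)) b.1))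
        (BlockNorm.ofBlocks (unitTorusGeo L K (MP (paramsOf d L mT K hL)))
          (fun b : Tor (fine (L ^ K) (MP (paramsOf d L mT K hL))) × Fin (d + 1) => blockOf (L ^ K) (MP (paramsOf d L mT K hL)) b.1))
        (knitGluedR d L s mT K (L ^ K) hL hs a) (fun y y' => B * Real.exp (-(δ * tdistT (MP (paramsOf d L mT K hL)) y y'))) := by
  -- the letters, all uniform in the volume
  obtain ⟨δG, βG, hδG, hβG, HG⟩ := hasMaj_chiCube_liftCubeG (d := d) hL ha
  obtain ⟨δD, βD, hδD, hβD, HD⟩ := hasMaj_chiCube_grad_liftCubeG (d := d) hL ha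
  obtain ⟨δB, βB, hδB, hβB, HB⟩ := hasMaj_chiCube_divAdjOut_liftCubeG_pair (d := d) hL ha
  obtain ⟨δ₀, C, hδ₀, hC, HC⟩ := hasMaj_chiCube_comp_liftCubeG_family (d := d) hL ha
  obtain ⟨δ₁, C₁, hδ₁, hC₁, HL⟩ := hasMaj_landauRe (d := d) (L := L)
  set δm : ℝ := min (min (min δG δD) (min δB δ₀)) δ₁ with hδm_def
  have hδm : 0 < δm := lt_min (lt_min (lt_min hδG hδD) (lt_min hδB hδ₀)) hδ₁
  have hmG : δm ≤ δG := (min_le_left _ _).trans ((min_le_left _ _).trans (min_le_left _ _))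
  have hmD : δm ≤ δD := (min_le_left _ _).trans ((min_le_left _ _).trans (min_le_right _ _))
  have hmB : δm ≤ δB := (min_le_left _ _).trans ((min_le_right _ _).trans (min_le_left _ _))
  have hm0 : δm ≤ δ₀ := (min_le_left _ _).trans ((min_le_right _ _).trans (min_le_right _ _))
  have hm1 : δm ≤ δ₁ := min_le_right _ _
  set cr : ℝ := B4Sect5Proof.latticeConst (d + 1) (δm / 4) with hcr_def
  have hcr : 0 ≤ cr := B4Sect5Proof.latticeConst_nonneg (d + 1) (by positivity)
  set β₁ : ℝ := max βD βB with hβ₁_def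
  have hβ₁ : 0 ≤ β₁ := hβD.le.trans (le_max_left _ _)
  set cN : ℝ := |a| * (Real.exp δm * Real.exp δm) + C₁ with hcN_def
  have hcN : 0 ≤ cN := by positivity
  set κ₀ : ℝ := (((d + 1 : ℕ) * (32 * π ^ 2 * βG + 2 * (π * β₁))) + 2 ^ (d + 1) * ((π * (d + 1) * (Real.exp 1 * (δm / 4))⁻¹ + 2 * (π * (d + 1))) * cN * (C * Real.exp δ₀) * cr) +
    cN * (8 / δm) * βG * cr) with hκ₀_def
  have hκ₀ : 0 ≤ κ₀ := by positivity
  set Nov : ℝ := ((((L + 1) ^ (d + 1) : ℕ)) : ℝ) with hNov_def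
  refine ⟨δm / 4, 2 * (Nov * κ₀) * cr + 1, 2 * (Nov * βG) * cr + 1, by positivity, by positivity, fun s mT K hs hK hw₀ => ?_⟩
  have hL3 : 3 ≤ L := by obtain ⟨⟨j, hj⟩, h1⟩ := hL; omega
  have hLpos : 0 < L := by omega
  set M : Fin (d + 1) → ℕ := MP (paramsOf d L mT K hL) with hMdef
  have hs' : s ≤ mT := by omega
  have hM : ∀ ν, M ν = 2 * L ^ (mT - s) * L ^ s := MP_eq_two_mul L s mT K hL hs'
  have hw : 0 < L ^ s := pow_pos hLpos s
  have hn : 1 ≤ L ^ K := Nat.one_le_pow _ _ hLpos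
  haveI : NeZero (L ^ (mT - s)) := ⟨pow_ne_zero _ (NeZero.ne L)⟩
  have hwR : (1 : ℝ) ≤ ((L ^ s : ℕ) : ℝ) := by exact_mod_cast hw
  have hwpos : (0 : ℝ) < ((L ^ s : ℕ) : ℝ) := by linarith
  have hSe : L ^ (s + 1) = L * L ^ s := by rw [pow_succ, mul_comm]
  have hfit : 2 * coverMargin L s + 2 * L ^ s + 1 ≤ L ^ (s + 1) := by rw [hSe]; exact coverMargin_fit hL3 s
  have hfit1 : coverMargin L s + 2 * L ^ s + 1 ≤ L ^ (s + 1) := by omega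
  have hS : L ^ (s + 1) ≤ 2 * L ^ (mT - s) * L ^ s := by
    rw [← hM 0]
    show L ^ (s + 1) ≤ 2 * L ^ mT
    have := Nat.pow_le_pow_right hLpos hs
    omega
  have hwm : ((L ^ s : ℕ) : ℝ) ≤ 2 * ((coverMargin L s : ℝ) + 1) := by exact_mod_cast le_two_mul_coverMargin hL3 s
  have hΘ := remainderConstR_le d (β₁ := β₁) (m₀ := ((coverMargin L s : ℕ) : ℝ)) (CC := C * Real.exp δ₀) hβG.le hcN hδm hcr hwR hwm
  have hrow := rowSum_unitTorusGeo (L := L) (k := K) (M := M) (σ := δm / 4) (by positivity)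
  -- the nonlocal part's letter and the commutator letter `O(w⁻¹)`
  have hN' := hasMaj_nonlocalPart (L := L) (kk := K) (M := M) (n := L ^ K) (a := a) hC₁.le hδm.le hm1 (HL K (L ^ K) M)
  have hind : ∀ (k : Fin (d + 1) → ZMod (2 * L ^ (mT - s))) (y y' : Tor M),
      0 ≤ ind (g := unitTorusGeo L K M) ((cubeBlocks M (coverCorner M (L ^ s) (L ^ (mT - s)) (coverMargin L s) k) (L ^ (s + 1)) : Finset (Tor M)) : Set (Tor M)) y *
        ind (g := unitTorusGeo L K M) ((cubeBlocks M (coverCorner M (L ^ s) (L ^ (mT - s)) (coverMargin L s) k) (L ^ (s + 1)) : Finset (Tor M)) : Set (Tor M)) y' :=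
    fun k y y' => mul_nonneg (ind_nonneg _ _) (ind_nonneg _ _)
  -- the cut rows of the lifted cubes at the common rate `δm ∕ 2`
  have hGc : ∀ k : Fin (d + 1) → ZMod (2 * L ^ (mT - s)),
      HasMaj (BlockNorm.ofBlocks (unitTorusGeo L K M) (fun b : Tor (fine (L ^ K) M) × Fin (d + 1) => blockOf (L ^ K) M b.1))
        (BlockNorm.ofBlocks (unitTorusGeo L K M) (fun b : Tor (fine (L ^ K) M) × Fin (d + 1) => blockOf (L ^ K) M b.1))
        (mulOp (chiCube M (L ^ K) (coverCorner M (L ^ s) (L ^ (mT - s)) (coverMargin L s) k) (L ^ (s + 1))) ∘ₗ knitGR d L s mT K (L ^ K) hL hs a k)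
        (fun y y' => ind ((cubeBlocks M (coverCorner M (L ^ s) (L ^ (mT - s)) (coverMargin L s) k) (L ^ (s + 1)) : Finset (Tor M)) : Set (Tor M)) y *
          ind ((cubeBlocks M (coverCorner M (L ^ s) (L ^ (mT - s)) (coverMargin L s) k) (L ^ (s + 1)) : Finset (Tor M)) : Set (Tor M)) y' *
          (βG * Real.exp (-(δm / 2 * tdistT M y y')))) := fun k =>
    hasMaj_rate_le (hind k) hβG.le (by linarith) (HG (s + 1) mT K hs hK _)
  have hDc : ∀ (k : Fin (d + 1) → ZMod (2 * L ^ (mT - s))) (μ : Fin (d + 1)),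
      HasMaj (BlockNorm.ofBlocks (unitTorusGeo L K M) (fun b : Tor (fine (L ^ K) M) × Fin (d + 1) => blockOf (L ^ K) M b.1))
        (BlockNorm.ofBlocks (unitTorusGeo L K M) (fun b : Tor (fine (L ^ K) M) × Fin (d + 1) => blockOf (L ^ K) M b.1))
        (mulOp (chiCube M (L ^ K) (coverCorner M (L ^ s) (L ^ (mT - s)) (coverMargin L s) k) (L ^ (s + 1))) ∘ₗ
          (fgrad ((L ^ K : ℕ) : ℝ) (bshiftEquiv M (L ^ K) μ) ∘ₗ knitGR d L s mT K (L ^ K) hL hs a k))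
        (fun y y' => ind ((cubeBlocks M (coverCorner M (L ^ s) (L ^ (mT - s)) (coverMargin L s) k) (L ^ (s + 1)) : Finset (Tor M)) : Set (Tor M)) y *
          ind ((cubeBlocks M (coverCorner M (L ^ s) (L ^ (mT - s)) (coverMargin L s) k) (L ^ (s + 1)) : Finset (Tor M)) : Set (Tor M)) y' *
          (β₁ * Real.exp (-(δm / 2 * tdistT M y y')))) := fun k μ => by
    rw [← symbOp_sD_eq]
    exact (hasMaj_rate_le (hind k) hβD.le (by linarith : δm / 2 ≤ δD) (HD (s + 1) mT K hs hK _ μ)).mono fun y y' =>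
      mul_le_mul_of_nonneg_left (mul_le_mul_of_nonneg_right (le_max_left _ _) (Real.exp_nonneg _)) (hind k y y')
  have hDbc : ∀ (k : Fin (d + 1) → ZMod (2 * L ^ (mT - s))) (μ : Fin (d + 1)),
      HasMaj (BlockNorm.ofBlocks (unitTorusGeo L K M) (fun b : Tor (fine (L ^ K) M) × Fin (d + 1) => blockOf (L ^ K) M b.1))
        (BlockNorm.ofBlocks (unitTorusGeo L K M) (fun b : Tor (fine (L ^ K) M) × Fin (d + 1) => blockOf (L ^ K) M b.1))
        (mulOp (chiCube M (L ^ K) (coverCorner M (L ^ s) (L ^ (mT - s)) (coverMargin L s) k) (L ^ (s + 1))) ∘ₗ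
          (bgrad ((L ^ K : ℕ) : ℝ) (bshiftEquiv M (L ^ K) μ) ∘ₗ knitGR d L s mT K (L ^ K) hL hs a k))
        (fun y y' => ind ((cubeBlocks M (coverCorner M (L ^ s) (L ^ (mT - s)) (coverMargin L s) k) (L ^ (s + 1)) : Finset (Tor M)) : Set (Tor M)) y *
          ind ((cubeBlocks M (coverCorner M (L ^ s) (L ^ (mT - s)) (coverMargin L s) k) (L ^ (s + 1)) : Finset (Tor M)) : Set (Tor M)) y' *
          (β₁ * Real.exp (-(δm / 2 * tdistT M y y')))) := fun k μ => by
    rw [bgrad_eq_neg_symbOp, LinearMap.neg_comp, LinearMap.comp_neg]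
    exact ((hasMaj_rate_le (hind k) hβB.le (by linarith : δm / 2 ≤ δB) ((HB (s + 1) mT K 0 hs hK _ μ).1)).mono fun y y' =>
      mul_le_mul_of_nonneg_left (mul_le_mul_of_nonneg_right (le_max_right _ _) (Real.exp_nonneg _)) (hind k y y')).neg
  -- the commutator half (β′)
  have hC : ∀ k : Fin (d + 1) → ZMod (2 * L ^ (mT - s)),
      HasMaj (BlockNorm.ofBlocks (unitTorusGeo L K M) (fun b : Tor (fine (L ^ K) M) × Fin (d + 1) => blockOf (L ^ K) M b.1))
        (BlockNorm.ofBlocks (unitTorusGeo L K M) (fun b : Tor (fine (L ^ K) M) × Fin (d + 1) => blockOf (L ^ K) M b.1))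
        (mulOp (chiCube M (L ^ K) (coverCorner M (L ^ s) (L ^ (mT - s)) (coverMargin L s) k) (L ^ (s + 1))) ∘ₗ
          (commOp (a • (qvAdjRe M (L ^ K) ∘ₗ qvRe M (L ^ K)) + (-landauRe M (L ^ K))) (knitHR d L s mT K (L ^ K) hL k) ∘ₗ knitGR d L s mT K (L ^ K) hL hs a k))
        (fun y y' => ind ((cubeBlocks M (coverCorner M (L ^ s) (L ^ (mT - s)) (coverMargin L s) k) (L ^ (s + 1)) : Finset (Tor M)) : Set (Tor M)) y *
          ind ((cubeBlocks M (coverCorner M (L ^ s) (L ^ (mT - s)) (coverMargin L s) k) (L ^ (s + 1)) : Finset (Tor M)) : Set (Tor M)) y' *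
          (2 ^ (d + 1) * ((π * (d + 1) / ((L ^ s : ℕ) : ℝ) * (Real.exp 1 * (δm / 4))⁻¹ + 2 * (π * (d + 1) / ((L ^ s : ℕ) : ℝ))) * cN * (C * Real.exp δ₀) * cr) *
            Real.exp (-(δm / 2 * tdistT M y y')))) := fun k => by
    have hcomm := hasMaj_commOp_coverH (L := L) (kk := K) (M := M) (n := L ^ K) (w := L ^ s) (q := L ^ (mT - s)) hM hw k hcN (by positivity : 0 < δm / 4) hN'
    have h := HC (s + 1) mT K hs hK (coverCorner M (L ^ s) (L ^ (mT - s)) (coverMargin L s) k) _ hrow (by positivity) (by positivity : 0 ≤ δm / 2) (by linarith)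
      (by linarith : δm / 2 + δm / 4 ≤ δm - δm / 4) hcomm
    exact h
  -- the remainder row of each cube, `≤ κ₀ ∕ L^s`
  have hK : ∀ k : Fin (d + 1) → ZMod (2 * L ^ (mT - s)),
      HasMaj (BlockNorm.ofBlocks (unitTorusGeo L K M) (fun b : Tor (fine (L ^ K) M) × Fin (d + 1) => blockOf (L ^ K) M b.1))
        (BlockNorm.ofBlocks (unitTorusGeo L K M) (fun b : Tor (fine (L ^ K) M) × Fin (d + 1) => blockOf (L ^ K) M b.1))
        (commOp (deltaOp M (L ^ K) a) (knitHR d L s mT K (L ^ K) hL k) ∘ₗ knitGR d L s mT K (L ^ K) hL hs a k)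
        (fun y y' => ind ((cubeBlocks M (coverCorner M (L ^ s) (L ^ (mT - s)) (coverMargin L s) k) (L ^ (s + 1)) : Finset (Tor M)) : Set (Tor M)) y' *
          (κ₀ / ((L ^ s : ℕ) : ℝ) * Real.exp (-(δm / 2 * tdistT M y y')))) := fun k => by
    rw [deltaOp_eq_lapOp_zero_add]
    have h := hasMaj_commOp_comp_cover_of (L := L) (kk := K) (M := M) (n := L ^ K) hM hw hfit hS k hβG.le hβ₁ (by positivity) hcN (by positivity : 0 ≤ δm / 2)
      (le_refl (δm / 2)) (by linarith : δm / 2 + δm / 4 ≤ 3 * δm / 4) (by linarith : 3 * δm / 4 ≤ δm) hrow (hGc k) (hDc k) (hDbc k) (hC k) hN'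
    exact h.mono fun y y' => mul_le_mul_of_nonneg_left (mul_le_mul_of_nonneg_right hΘ (Real.exp_nonneg _)) (ind_nonneg _ _)
  -- (2.36), overlap, the remainder's letter, the unit
  have hh : ∀ (k : Fin (d + 1) → ZMod (2 * L ^ (mT - s))) x, |knitHR d L s mT K (L ^ K) hL k x| ≤ 1 := fun k x => abs_coverH_le_one k x
  have hNovEq : L ^ (s + 1) / L ^ s + 1 = L + 1 := by rw [pow_succ, Nat.mul_div_cancel_left L hw]
  have hN : ∀ y : Tor M, ∑ k : Fin (d + 1) → ZMod (2 * L ^ (mT - s)),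
      ind (g := unitTorusGeo L K M) ((cubeBlocks M (coverCorner M (L ^ s) (L ^ (mT - s)) (coverMargin L s) k) (L ^ (s + 1)) : Finset (Tor M)) : Set (Tor M)) y ≤ Nov := fun y => by
    have := sum_ind_cubeBlocks_le_overlap (M := M) (w := L ^ s) (q := L ^ (mT - s)) (m₀ := coverMargin L s) (S := L ^ (s + 1)) hM hw L K y
    rwa [hNovEq] at this
  have hR := hasMaj_remainder_in (g := unitTorusGeo L K M) (fun b : Tor (fine (L ^ K) M) × Fin (d + 1) => blockOf (L ^ K) M b.1)
    (fun k => ((cubeBlocks M (coverCorner M (L ^ s) (L ^ (mT - s)) (coverMargin L s) k) (L ^ (s + 1)) : Finset (Tor M)) : Set (Tor M)))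
    (Δ := deltaOp M (L ^ K) a) (h := knitHR d L s mT K (L ^ K) hL) (G := knitGR d L s mT K (L ^ K) hL hs a) (θ₀ := κ₀ / ((L ^ s : ℕ) : ℝ)) (δ := δm / 2) (Nov := Nov)
    (by positivity) hh hN hK
  have hMge : 2 * (Nov * κ₀) * cr ≤ ((L ^ s : ℕ) : ℝ) := by linarith
  obtain ⟨hq, -⟩ := glued_smallness_of_M (cr := cr) (κ₀ := κ₀) (Nov := Nov) hwpos hMge
  have hunit := isUnit_neumannR (g := unitTorusGeo L K M) (fun b : Tor (fine (L ^ K) M) × Fin (d + 1) => blockOf (L ^ K) M b.1) (unitTorusGeo_dist_nonneg L K M) hrow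
    (by positivity) (by linarith : δm / 4 ≤ δm / 2) hR hq
  -- (2.91) from (2.36) and per-cube locality
  have hloc : ∀ k, mulOp (knitHR d L s mT K (L ^ K) hL k) ∘ₗ deltaOp M (L ^ K) a ∘ₗ knitGR d L s mT K (L ^ K) hL hs a k = mulOp (knitHR d L s mT K (L ^ K) hL k) := fun k =>
    mulOp_comp_deltaOp_comp_liftCubeG_family hL ha hs (coverCorner M (L ^ s) (L ^ (mT - s)) (coverMargin L s) k)
      fun b hb => mem_intBonds_of_hcube_ne_zero_side (m₀ := coverMargin L s) hM hw hfit1 hS hb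
  have h291 := lap_comp_parametrix (Δ := deltaOp M (L ^ K) a) (fun x => sum_coverH_sq (M := M) (n := L ^ K) (w := L ^ s) (q := L ^ (mT - s)) x) hloc
  refine ⟨⟨lap_comp_glueInv hunit h291, glueInv_comp_lap hunit h291, (eq_glueInv_of_comp_lap hunit h291 (gOp_comp_deltaOp M (L ^ K) a hn ha)).symm⟩, ?_⟩
  -- the machine's letter: parametrix (cut) + remainder + resummation, `w`-live
  have hcut : ∀ k : Fin (d + 1) → ZMod (2 * L ^ (mT - s)),
      mulOp (knitHR d L s mT K (L ^ K) hL k) ∘ₗ mulOp (chiCube M (L ^ K) (coverCorner M (L ^ s) (L ^ (mT - s)) (coverMargin L s) k) (L ^ (s + 1))) =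
        mulOp (knitHR d L s mT K (L ^ K) hL k) := fun k =>
    hcube_cut (2 * L ^ (mT - s)) (coverXi M (L ^ K) (L ^ s)) (bshiftEquiv M (L ^ K)) 0
      (chiCube_coverCorner_eq_one_side (M := M) (n := L ^ K) (m₀ := coverMargin L s) hM hw hfit1 hS 0 k)
  have hP := hasMaj_parametrix (g := unitTorusGeo L K M) (fun b : Tor (fine (L ^ K) M) × Fin (d + 1) => blockOf (L ^ K) M b.1)
    (fun k => ((cubeBlocks M (coverCorner M (L ^ s) (L ^ (mT - s)) (coverMargin L s) k) (L ^ (s + 1)) : Finset (Tor M)) : Set (Tor M))) (h := knitHR d L s mT K (L ^ K) hL)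
    hβG.le hh hN hGc
  have ecut := parametrix_cut (G := knitGR d L s mT K (L ^ K) hL hs a) hcut
  have hP' : HasMaj (BlockNorm.ofBlocks (unitTorusGeo L K M) (fun b : Tor (fine (L ^ K) M) × Fin (d + 1) => blockOf (L ^ K) M b.1))
      (BlockNorm.ofBlocks (unitTorusGeo L K M) (fun b : Tor (fine (L ^ K) M) × Fin (d + 1) => blockOf (L ^ K) M b.1))
      (parametrix (knitHR d L s mT K (L ^ K) hL) (knitGR d L s mT K (L ^ K) hL hs a)) (fun y y' => Nov * βG * Real.exp (-(δm / 2 * tdistT M y y'))) :=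
    hP.congr fun μ => LinearMap.congr_fun ecut μ
  have hR' : HasMaj (BlockNorm.ofBlocks (unitTorusGeo L K M) (fun b : Tor (fine (L ^ K) M) × Fin (d + 1) => blockOf (L ^ K) M b.1))
      (BlockNorm.ofBlocks (unitTorusGeo L K M) (fun b : Tor (fine (L ^ K) M) × Fin (d + 1) => blockOf (L ^ K) M b.1))
      (remainder (deltaOp M (L ^ K) a) (knitHR d L s mT K (L ^ K) hL) (knitGR d L s mT K (L ^ K) hL hs a))
      (fun y y' => Nov * κ₀ / ((L ^ s : ℕ) : ℝ) * Real.exp (-(δm / 2 * tdistT M y y'))) := hR.mono fun y y' => le_of_eq (by ring)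
  have hdec := hasMaj_glueInv_of_M (g := unitTorusGeo L K M) (fun b : Tor (fine (L ^ K) M) × Fin (d + 1) => blockOf (L ^ K) M b.1) (triangle254_unitTorusGeo L K M)
    (unitTorusGeo_dist_nonneg L K M) (unitTorusGeo_dist_self L K M) hrow (by positivity) hcr (mul_nonneg (by positivity) hβG.le) (mul_nonneg (by positivity) hκ₀) hwpos hMge
    (by linarith : 2 * (δm / 4) ≤ δm / 2) hP' hR'
  refine hdec.mono fun y y' => ?_
  rw [show δm / 2 - δm / 4 = δm / 4 by ring]
  exact mul_le_mul_of_nonneg_right (by linarith) (Real.exp_nonneg _)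

end Knit

end Summit.QuantumFields.YangMills.BalabanUVNodes.N15.Gluing

end
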